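import Mathlib
import HarnessLib
import Summits.HubbardSuperconductivity.HubbardSuperconductivity.Theorems.KLProgrammeKLRegimeSplitPairLadder

/-!
# Route `KLProgramme` — row 0′ completed: (B1-v2) `PairArrayAt`-type control of the pair arrays for EVERY total momentum of
# torus size `≤ 1`, from the ladder steps (E2-v2) while in the pair class and the frozen value increments (E2″-v2) afterwards

Cell gate-hubbard-kl, seat p3; continuation of `KLProgrammeKLRegimeSplitPairLadder.lean`.  A total momentum `Q` with
`|p_Q|_𝕋 ≤ 1` is in the pair class up to a last scale `t ≤ n` (`Nat.findGreatest`); up to `t` the ladder gives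
`|𝒞_t(Q) - u| ≤ 8A_t` (`pairLadder_envelope`); from `t` to `n` the pair momentum is resolved (`|p_Q|_𝕋 > 4^{-(t+1)}`), so the
particle–particle gains of the value increments (E2″-v2) `PairValueIncrementAt` are summable by `G.WF` (`Σ_{j ∈ (t,N]} ppGain j ρ ≤ CF`),
the particle–hole gains are summable uniformly (`≤ CF` each), and the remainders sum to `Σ ē`:
**`pairFrozen_increment`** (`|𝒞_n(Q) - 𝒞_t(Q)| ≤ (Klam U)²·3CF + Σ_{i<n} ē_i` on the ball) and the assembly
**`pairArray_envelope`** (`∃ u ∈ [0, U], |𝒞_n(Q;k,k') - u| ≤ 8A_n + (Klam U)²·3CF + Σ_{i<n} ē_i` for every `Q` with `IsPairClassAt L Q 0`).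
The remaining total momenta (`1 < |p_Q|_𝕋 ≤ π`, never in any pair class) need the `n = 0` value clause for all `Q` (STATUS Q-a to p1).
Everything is proved; no definitions.
-/

noncomputable section

namespace Summit.HubbardSuperconductivity.HubbardSuperconductivity.Theorems.KLRegimeSplit

set_option linter.dupNamespace false -- summit = problem name (single-conjunct summit), D-0017

open Finset Literature.MathematicalPhysics.QuantumLattice Literature.Probability.LatticeModels
open Summit.HubbardSuperconductivity.HubbardSuperconductivity.Theorems.KLProgrammeLegKernels
open Summit.HubbardSuperconductivity.HubbardSuperconductivity.Theorems.CooperChannelRiccatiFlow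
open Summit.HubbardSuperconductivity.HubbardSuperconductivity.Theorems.SWaveCascade

section Model

variable (L M : ℕ) [NeZero L] [NeZero M]

omit [NeZero L] [NeZero M] in
/-- The torus size of a momentum is nonnegative. -/
theorem torusSupNorm_nonneg (p : ℝ × ℝ) : 0 ≤ torusSupNorm p :=
  le_max_of_le_left (abs_nonneg _)

variable {G : GeoConsts} {P : SplitConsts} {Qc : EngConsts}

/-- **Frozen increments**: once the pair momentum is resolved (`|p_Q|_𝕋 > 4^{-(t+1)}`), the value increments (E2″-v2) from
`t` to `n` sum to `(Klam U)²·3CF + Σ_{i<n} ē_i` on the ball. -/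
theorem pairFrozen_increment (hG : G.WF) (hP : P.WF) (hQc : Qc.WF) {β U μ : ℝ} {K : TrigPolyC4v} {t n : ℕ} (htn : t ≤ n)
    (hincr : ∀ j, t < j → j ≤ n → PairValueIncrementAt L M G P Qc β U μ K j) {Qm : TorusSite 2 L}
    (hexit : ((4 : ℝ) ^ (t + 1))⁻¹ < torusSupNorm (latticeMomentum L Qm 0, latticeMomentum L Qm 1)) :
    ∀ k ∈ klBall L μ K, ∀ k' ∈ klBall L μ K,
      ‖klPairAmplitude L M β U μ K n Qm k k' - klPairAmplitude L M β U μ K t Qm k k'‖ ≤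
        (P.Klam * U) ^ 2 * (3 * G.CF) + ∑ i ∈ range n, eremBar G P Qc U β L i := by
  intro k hk k' hk'
  have hG' := hG
  obtain ⟨-, -, -, -, -, -, -, -, -, -, -, hpp0, hph0, hCF, hphsum, hppsum, -⟩ := hG
  set ρQ := torusSupNorm (latticeMomentum L Qm 0, latticeMomentum L Qm 1) with hρQ
  set ρd := torusSupNorm (latticeMomentum L (k - k') 0, latticeMomentum L (k - k') 1) with hρd
  set ρx := torusSupNorm (latticeMomentum L (k + k' - Qm) 0, latticeMomentum L (k + k' - Qm) 1) with hρx
  set 𝒞 : ℕ → ℂ := fun j => klPairAmplitude L M β U μ K j Qm k k' with h𝒞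
  -- telescoping with partial sums
  have key : ∀ m, t ≤ m → m ≤ n → ‖𝒞 m - 𝒞 t‖ ≤
      (P.Klam * U) ^ 2 * ((∑ j ∈ Ioc t m, G.ppGain j ρQ) + (∑ j ∈ Ioc t m, G.phGain j ρd) +
        (∑ j ∈ Ioc t m, G.phGain j ρx)) + ∑ i ∈ Ico t m, eremBar G P Qc U β L i := by
    intro m htm
    induction m, htm using Nat.le_induction with
    | base => intro; simp
    | succ m htm ih =>
      intro hmn
      have ih' := ih (Nat.le_of_succ_le hmn)
      have hstep := hincr (m + 1) (Nat.lt_succ_of_le htm) hmn (Nat.le_add_left 1 m) Qm k hk k' hk'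
      simp only [Nat.add_sub_cancel] at hstep
      rw [sum_Ioc_succ_top (by omega), sum_Ioc_succ_top (by omega), sum_Ioc_succ_top (by omega),
        sum_Ico_succ_top htm]
      have htri : ‖𝒞 (m + 1) - 𝒞 t‖ ≤ ‖𝒞 (m + 1) - 𝒞 m‖ + ‖𝒞 m - 𝒞 t‖ := by
        rw [show 𝒞 (m + 1) - 𝒞 t = (𝒞 (m + 1) - 𝒞 m) + (𝒞 m - 𝒞 t) by ring]; exact norm_add_le _ _
      have hg : ‖𝒞 (m + 1) - 𝒞 m‖ ≤ gainBar G P U (m + 1) ρQ ρd ρx + eremBar G P Qc U β L m := hstep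
      unfold gainBar at hg
      nlinarith [hg, htri, ih', sq_nonneg (P.Klam * U)]
  have hfin := key n htn le_rfl
  -- summing the gains
  have hρQ0 : 0 ≤ ρQ := torusSupNorm_nonneg _
  have h1 : ∑ j ∈ Ioc t n, G.ppGain j ρQ ≤ G.CF := hppsum ρQ t n hexit
  have h2 : ∑ j ∈ Ioc t n, G.phGain j ρd ≤ G.CF :=
    (sum_le_sum_of_subset_of_nonneg (fun j hj => by simp only [mem_Ioc] at hj; exact mem_range.2 (by omega))
      fun j _ _ => hph0 j ρd).trans (hphsum ρd (n + 1) (torusSupNorm_nonneg _))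
  have h3 : ∑ j ∈ Ioc t n, G.phGain j ρx ≤ G.CF :=
    (sum_le_sum_of_subset_of_nonneg (fun j hj => by simp only [mem_Ioc] at hj; exact mem_range.2 (by omega))
      fun j _ _ => hph0 j ρx).trans (hphsum ρx (n + 1) (torusSupNorm_nonneg _))
  have h4 : ∑ i ∈ Ico t n, eremBar G P Qc U β L i ≤ ∑ i ∈ range n, eremBar G P Qc U β L i :=
    sum_le_sum_of_subset_of_nonneg (fun i hi => by simp only [mem_Ico] at hi; exact mem_range.2 hi.2)
      fun i _ _ => eremBar_nonneg' hG' hP hQc U β L i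
  · nlinarith [hfin, h1, h2, h3, h4, sq_nonneg (P.Klam * U)]


/-- **Row 0′ for every total momentum of torus size `≤ 1` ((B1-v2)-shaped).**  Ladder while in the pair class
(`pairLadder_envelope` up to the last pair-class scale `t = Nat.findGreatest`), frozen increments afterwards
(`pairFrozen_increment`). -/
theorem pairArray_envelope (hG : G.WF) (hP : P.WF) (hQc : Qc.WF) {β U μ : ℝ} {K : TrigPolyC4v} (hU : 0 ≤ U) {n : ℕ}
    (hsteps : ∀ j ≤ n, PairLadderStepAt L M G P Qc β U μ K j)
    (hincr : ∀ j, 1 ≤ j → j ≤ n → PairValueIncrementAt L M G P Qc β U μ K j) {Qm : TorusSite 2 L}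
    (hQ0 : IsPairClassAt L Qm 0)
    (hsmall₁ : G.bhi * (U + 8 * (initDevBar G U +
      2 * ∑ j ∈ range n, (drivePBar G P U j + eremBar G P Qc U β L j))) ≤ 1)
    (hsmall₂ : 8 * 16 * (initDevBar G U + 2 * ∑ j ∈ range n, (drivePBar G P U j + eremBar G P Qc U β L j)) *
      (G.bhi * n) ≤ 1) :
    ∃ u : ℝ, 0 ≤ u ∧ u ≤ U ∧ ∀ k ∈ klBall L μ K, ∀ k' ∈ klBall L μ K,
      ‖klPairAmplitude L M β U μ K n Qm k k' - (u : ℂ)‖ ≤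
        8 * (initDevBar G U + 2 * ∑ j ∈ range n, (drivePBar G P U j + eremBar G P Qc U β L j)) +
          ((P.Klam * U) ^ 2 * (3 * G.CF) + ∑ i ∈ range n, eremBar G P Qc U β L i) := by
  classical
  set τ : ℕ → ℝ := fun j => drivePBar G P U j + eremBar G P Qc U β L j with hτ
  have hτ0 : ∀ j, 0 ≤ τ j := fun j => add_nonneg (drivePBar_nonneg' hG U j) (eremBar_nonneg' hG hP hQc U β L j)
  have hbhi : 0 ≤ G.bhi := hG.2.2.1.trans hG.2.2.2.1
  have hinit0 : 0 ≤ initDevBar G U := by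
    unfold initDevBar
    refine mul_nonneg (add_nonneg (sum_nonneg fun χ _ => add_nonneg (hG.2.1 χ) (hG.1 χ)) zero_le_one) (sq_nonneg U)
  have hCF : 0 ≤ G.CF := hG.2.2.2.2.2.2.2.2.2.2.2.2.2.1
  -- the last pair-class scale
  set t : ℕ := Nat.findGreatest (fun s => IsPairClassAt L Qm s) n with ht_def
  have htn : t ≤ n := Nat.findGreatest_le n
  have hQt : IsPairClassAt L Qm t := Nat.findGreatest_spec (P := fun s => IsPairClassAt L Qm s) (Nat.zero_le n) hQ0
  -- monotonicity of the majorant in the horizon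
  have hAt : initDevBar G U + 2 * ∑ j ∈ range t, τ j ≤ initDevBar G U + 2 * ∑ j ∈ range n, τ j :=
    add_le_add le_rfl (mul_le_mul_of_nonneg_left (sum_le_sum_of_subset_of_nonneg (range_mono htn) fun j _ _ => hτ0 j)
      (by norm_num))
  have hA0 : 0 ≤ initDevBar G U + 2 * ∑ j ∈ range t, τ j :=
    add_nonneg hinit0 (mul_nonneg (by norm_num) (sum_nonneg fun j _ => hτ0 j))
  have hsmall₁' : G.bhi * (U + 8 * (initDevBar G U + 2 * ∑ j ∈ range t, τ j)) ≤ 1 :=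
    (mul_le_mul_of_nonneg_left (by linarith) hbhi).trans hsmall₁
  have hsmall₂' : 8 * 16 * (initDevBar G U + 2 * ∑ j ∈ range t, τ j) * (G.bhi * t) ≤ 1 := by
    refine le_trans ?_ hsmall₂
    exact mul_le_mul (mul_le_mul_of_nonneg_left hAt (by norm_num))
      (mul_le_mul_of_nonneg_left (by exact_mod_cast htn) hbhi) (mul_nonneg hbhi (Nat.cast_nonneg t))
      (mul_nonneg (by norm_num) (hA0.trans hAt))
  -- the ladder up to `t`
  obtain ⟨u, hu0, huU, hu⟩ := pairLadder_envelope L M hG hP hQc hU (n := t) (fun j hj => hsteps j (hj.trans htn)) hQt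
    hsmall₁' hsmall₂'
  refine ⟨u, hu0, huU, fun k hk k' hk' => ?_⟩
  -- the frozen part from `t` to `n`
  have hfrozen : ‖klPairAmplitude L M β U μ K n Qm k k' - klPairAmplitude L M β U μ K t Qm k k'‖ ≤
      (P.Klam * U) ^ 2 * (3 * G.CF) + ∑ i ∈ range n, eremBar G P Qc U β L i := by
    rcases htn.eq_or_lt with h | h
    · rw [← h, sub_self, norm_zero]
      exact add_nonneg (mul_nonneg (sq_nonneg _) (by linarith)) (sum_nonneg fun i _ => eremBar_nonneg' hG hP hQc U β L i)
    · have hnot : ¬ IsPairClassAt L Qm (t + 1) :=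
        Nat.findGreatest_is_greatest (P := fun s => IsPairClassAt L Qm s) (Nat.lt_succ_self t) (Nat.succ_le_of_lt h)
      have hexit : ((4 : ℝ) ^ (t + 1))⁻¹ < torusSupNorm (latticeMomentum L Qm 0, latticeMomentum L Qm 1) :=
        lt_of_not_ge hnot
      exact pairFrozen_increment L M hG hP hQc htn (fun j hj hjn => hincr j (by omega) hjn) hexit k hk k' hk'
  have hlad := hu k hk k' hk'
  calc ‖klPairAmplitude L M β U μ K n Qm k k' - (u : ℂ)‖
      ≤ ‖klPairAmplitude L M β U μ K t Qm k k' - (u : ℂ)‖ +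
          ‖klPairAmplitude L M β U μ K n Qm k k' - klPairAmplitude L M β U μ K t Qm k k'‖ := by
        rw [show klPairAmplitude L M β U μ K n Qm k k' - (u : ℂ) =
          (klPairAmplitude L M β U μ K t Qm k k' - (u : ℂ)) +
            (klPairAmplitude L M β U μ K n Qm k k' - klPairAmplitude L M β U μ K t Qm k k') by ring]
        exact norm_add_le _ _
    _ ≤ _ := by
        have := add_le_add hlad hfrozen
        refine this.trans ?_
        simp only [hτ]
        linarith [hAt]


/-- **Frozen increments with an extra per-step term** (robust to later bundles, e.g. V4's `thermalBar + legBar`): if the value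
increments from `t` to `n` are bounded by `gainBar + X j k k' + ē_{j-1}` with `Σ_{j∈(t,n]} X j k k' ≤ Xtot`, and the pair momentum is
resolved (`|p_Q|_𝕋 > 4^{-(t+1)}`), then `|𝒞_n(Q;k,k') - 𝒞_t(Q;k,k')| ≤ (Klam U)²·3CF + Xtot + Σ_{i<n} ē_i`. -/
theorem pairFrozen_increment_extra (hG : G.WF) (hP : P.WF) (hQc : Qc.WF) {β U μ : ℝ} {K : TrigPolyC4v} {t n : ℕ} (htn : t ≤ n)
    {Qm : TorusSite 2 L} (X : ℕ → TorusSite 2 L → TorusSite 2 L → ℝ) {Xtot : ℝ}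
    (hincr : ∀ j, t < j → j ≤ n → ∀ k ∈ klBall L μ K, ∀ k' ∈ klBall L μ K,
      ‖klPairAmplitude L M β U μ K j Qm k k' - klPairAmplitude L M β U μ K (j - 1) Qm k k'‖ ≤
        gainBar G P U j (torusSupNorm (latticeMomentum L Qm 0, latticeMomentum L Qm 1))
            (torusSupNorm (latticeMomentum L (k - k') 0, latticeMomentum L (k - k') 1))
            (torusSupNorm (latticeMomentum L (k + k' - Qm) 0, latticeMomentum L (k + k' - Qm) 1)) +
          X j k k' + eremBar G P Qc U β L (j - 1))
    (hX : ∀ k ∈ klBall L μ K, ∀ k' ∈ klBall L μ K, ∑ j ∈ Ioc t n, X j k k' ≤ Xtot)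
    (hexit : ((4 : ℝ) ^ (t + 1))⁻¹ < torusSupNorm (latticeMomentum L Qm 0, latticeMomentum L Qm 1)) :
    ∀ k ∈ klBall L μ K, ∀ k' ∈ klBall L μ K,
      ‖klPairAmplitude L M β U μ K n Qm k k' - klPairAmplitude L M β U μ K t Qm k k'‖ ≤
        (P.Klam * U) ^ 2 * (3 * G.CF) + Xtot + ∑ i ∈ range n, eremBar G P Qc U β L i := by
  intro k hk k' hk'
  have hG' := hG
  obtain ⟨-, -, -, -, -, -, -, -, -, -, -, hpp0, hph0, hCF, hphsum, hppsum, -⟩ := hG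
  set ρQ := torusSupNorm (latticeMomentum L Qm 0, latticeMomentum L Qm 1) with hρQ
  set ρd := torusSupNorm (latticeMomentum L (k - k') 0, latticeMomentum L (k - k') 1) with hρd
  set ρx := torusSupNorm (latticeMomentum L (k + k' - Qm) 0, latticeMomentum L (k + k' - Qm) 1) with hρx
  set 𝒞 : ℕ → ℂ := fun j => klPairAmplitude L M β U μ K j Qm k k' with h𝒞
  have key : ∀ m, t ≤ m → m ≤ n → ‖𝒞 m - 𝒞 t‖ ≤
      (P.Klam * U) ^ 2 * ((∑ j ∈ Ioc t m, G.ppGain j ρQ) + (∑ j ∈ Ioc t m, G.phGain j ρd) +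
        (∑ j ∈ Ioc t m, G.phGain j ρx)) + (∑ j ∈ Ioc t m, X j k k') + ∑ i ∈ Ico t m, eremBar G P Qc U β L i := by
    intro m htm
    induction m, htm using Nat.le_induction with
    | base => intro; simp
    | succ m htm ih =>
      intro hmn
      have ih' := ih (Nat.le_of_succ_le hmn)
      have hstep := hincr (m + 1) (Nat.lt_succ_of_le htm) hmn k hk k' hk'
      simp only [Nat.add_sub_cancel] at hstep
      rw [sum_Ioc_succ_top (by omega), sum_Ioc_succ_top (by omega), sum_Ioc_succ_top (by omega),
        sum_Ioc_succ_top (by omega), sum_Ico_succ_top htm]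
      have htri : ‖𝒞 (m + 1) - 𝒞 t‖ ≤ ‖𝒞 (m + 1) - 𝒞 m‖ + ‖𝒞 m - 𝒞 t‖ := by
        rw [show 𝒞 (m + 1) - 𝒞 t = (𝒞 (m + 1) - 𝒞 m) + (𝒞 m - 𝒞 t) by ring]; exact norm_add_le _ _
      have hg : ‖𝒞 (m + 1) - 𝒞 m‖ ≤ gainBar G P U (m + 1) ρQ ρd ρx + X (m + 1) k k' + eremBar G P Qc U β L m := hstep
      unfold gainBar at hg
      nlinarith [hg, htri, ih', sq_nonneg (P.Klam * U)]
  have hfin := key n htn le_rfl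
  have h1 : ∑ j ∈ Ioc t n, G.ppGain j ρQ ≤ G.CF := hppsum ρQ t n hexit
  have h2 : ∑ j ∈ Ioc t n, G.phGain j ρd ≤ G.CF :=
    (sum_le_sum_of_subset_of_nonneg (fun j hj => by simp only [mem_Ioc] at hj; exact mem_range.2 (by omega))
      fun j _ _ => hph0 j ρd).trans (hphsum ρd (n + 1) (torusSupNorm_nonneg _))
  have h3 : ∑ j ∈ Ioc t n, G.phGain j ρx ≤ G.CF :=
    (sum_le_sum_of_subset_of_nonneg (fun j hj => by simp only [mem_Ioc] at hj; exact mem_range.2 (by omega))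
      fun j _ _ => hph0 j ρx).trans (hphsum ρx (n + 1) (torusSupNorm_nonneg _))
  have h4 : ∑ i ∈ Ico t n, eremBar G P Qc U β L i ≤ ∑ i ∈ range n, eremBar G P Qc U β L i :=
    sum_le_sum_of_subset_of_nonneg (fun i hi => by simp only [mem_Ico] at hi; exact mem_range.2 hi.2)
      fun i _ _ => eremBar_nonneg' hG' hP hQc U β L i
  have h5 := hX k hk k' hk'
  nlinarith [hfin, h1, h2, h3, h4, h5, sq_nonneg (P.Klam * U)]

end Model

end Summit.HubbardSuperconductivity.HubbardSuperconductivity.Theorems.KLRegimeSplit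

end
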